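import Summits.QuantumFields.YangMills.Theorems.ColdStartUniversalityLatticeLangevinWilsonSpectralGapMeasurable
import Summits.QuantumFields.YangMills.Theorems.ColdStartUniversalityLatticeLangevinLawDensityBound
import HarnessLib

/-!
# Route `ColdStartUniversality` (fixed-cut-off `L²(μ_{β'})` package): `L²` MIXING FROM A COLD START for bounded measurable
# observables and EVENTS — `(P(U_{t₁+t} ∈ A) − μ(A))² ≤ D · e^{-2ct} · μ(A)(1 − μ(A))`

Helper file (seat `ym-line-csu-p1`, g16), sequel of `…WilsonSpectralGapMeasurable` (variance decay for bounded measurable `F`)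
and `…WilsonSpectralGapColdStart` (the continuous-observable version).  For the SU(2) lattice Langevin dynamics at any coupling
`β'`, `μ = μ_{β'}`, `c = c(L, β') > 0` the Doeblin rate:

* `sq_integral_le_mul_integral_sq_of_measurable` — Jensen + domination `ν ≤ D μ ⇒ (∫ G dν)² ≤ D ∫ G² dμ`, bounded measurable `G`;
* ★ `coldStart_measurable_sq_sub_le_exp` — for every start `z` and burn-in `t₁ > 0` there is `D = D(L, β', z, t₁) ≥ 0` with:
  for EVERY strong solution `U` from `z` on ANY probability space, every bounded measurable `F`, every event `A` and every `t`,
  `(E F(U_{t₁+t}) − μF)² ≤ D e^{-2ct} Var_μ(F)` and `(P(U_{t₁+t} ∈ A) − μ(A))² ≤ D e^{-2ct} μ(A)(1 − μ(A))`.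

Reading: a RELATIVE-ERROR mixing statement at fixed cut-off — events that are rare under the Wilson measure are hit by the
cold-start dynamics with correspondingly small probability, uniformly exponentially in the lattice time after burn-in; the
sup-norm Harris bound `exp_mixing_szz` only gives the absolute error `C e^{-ct}`.  THEOREMS ONLY, no definition, no sorry.
HONEST FRAMING: fixed-cut-off plumbing (`c, D` depend on the cut-off); no rung, crux or summit statement is proved; the
Yang–Mills mass gap is NOT proved.
-/

set_option autoImplicit false

noncomputable section

namespace Summit.QuantumFields.YangMills.Theorems.ColdStartUniversality

open MeasureTheory ProbabilityTheory Finset Filter Set Topology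
open scoped BigOperators NNReal ENNReal
open Literature.Probability.Process Literature.MathematicalPhysics.QuantumFieldTheory
open Literature.MathematicalPhysics.QuantumLattice (fundamentalRep fundamentalLatticeRep continuous_fundamentalRep)

variable {L : ℕ} [NeZero L]

/-- **Jensen + domination** for bounded measurable `G`: if `ν ≤ D · μ` (`ν` a probability measure, `μ` finite) then
`(∫ G dν)² ≤ D ∫ G² dμ`. [folklore] -/
theorem sq_integral_le_mul_integral_sq_of_measurable {Y : Type*} [MeasurableSpace Y] {ν μ : Measure Y}
    [IsProbabilityMeasure ν] [IsFiniteMeasure μ] {D : ℝ} (hD : 0 ≤ D) (hle : ν ≤ (ENNReal.ofReal D) • μ)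
    {G : Y → ℝ} (hG : Measurable G) {C : ℝ} (hC : ∀ y, |G y| ≤ C) :
    (∫ y, G y ∂ν) ^ 2 ≤ D * ∫ y, (G y) ^ 2 ∂μ := by
  have h1 : (∫ y, G y ∂ν) ^ 2 ≤ ∫ y, (G y) ^ 2 ∂ν := sq_integral_le_integral_sq_of_bounded ν hG hC
  have hGi : Integrable (fun y => (G y) ^ 2) ((ENNReal.ofReal D) • μ) :=
    (integrable_of_abs_le μ (hG.pow_const 2) (C := C ^ 2) fun y => by
      rw [abs_pow]; exact pow_le_pow_left₀ (abs_nonneg _) (hC y) 2).smul_measure ENNReal.ofReal_ne_top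
  have h2 : ∫ y, (G y) ^ 2 ∂ν ≤ ∫ y, (G y) ^ 2 ∂((ENNReal.ofReal D) • μ) :=
    integral_mono_measure hle (Eventually.of_forall fun y => sq_nonneg (G y)) hGi
  rw [integral_smul_measure, ENNReal.toReal_ofReal hD, smul_eq_mul] at h2
  exact h1.trans h2

/-- ★ **`L²` mixing from a deterministic start, bounded measurable observables and events.**  There is `c > 0` such that for
every start `z` and burn-in `t₁ > 0` there is `D ≥ 0` with: for EVERY strong solution `U` of the SZZ dynamics at `β'` from `z`
on ANY probability space, (i) for every bounded measurable `F` and every `t`,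
`(∫ F(U_{t₁+t}) dP − ∫ F dμ_{β'})² ≤ D e^{-2ct} ∫ (F − μF)² dμ_{β'}`; (ii) for every measurable `A` and every `t`,
`(law(U_{t₁+t})(A) − μ_{β'}(A))² ≤ D e^{-2ct} μ_{β'}(A)(1 − μ_{β'}(A))`.
[cite: RobertsRosenthal1997, Theorem 2.1] [cite: ShenZhuZhu2022, §3 Lemma 3.3 (p. 13)] -/
theorem coldStart_measurable_sq_sub_le_exp (L : ℕ) [NeZero L] (β' : ℝ) :
    ∃ c : ℝ, 0 < c ∧
      ∀ (z : GaugeConfig 3 L (Matrix.specialUnitaryGroup (Fin 2) ℂ)) (t₁ : ℝ≥0), 0 < (t₁ : ℝ) →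
        ∃ D : ℝ, 0 ≤ D ∧
          ∀ (Ω : Type) [MeasurableSpace Ω] (P : Measure Ω) [IsProbabilityMeasure P]
            (W : ℝ≥0 → Ω → (Edge 3 L × NoiseIdx 2 → ℝ)) (hW : IsFlatBrownian W P)
            (U : ℝ≥0 → Ω → GaugeConfig 3 L (Matrix.specialUnitaryGroup (Fin 2) ℂ)),
            (∀ ω, U 0 ω = z) →
            (latticeLangevinDynamics (fundamentalLatticeRep 2) β').IsSolution (fundamentalRep (Fin 2))
              hW.natFiltration P W U →
            (∀ (F : GaugeConfig 3 L (Matrix.specialUnitaryGroup (Fin 2) ℂ) → ℝ), Measurable F →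
              ∀ M : ℝ, (∀ x, |F x| ≤ M) → ∀ t : ℝ≥0,
              ((∫ ω, F (U (t₁ + t) ω) ∂P) - ∫ x, F x ∂(wilsonMeasure (d := 3) (L := L) (fundamentalRep (Fin 2)) β')) ^ 2 ≤
                D * Real.exp (-2 * c * t) *
                  ∫ x, (F x - ∫ z, F z ∂(wilsonMeasure (d := 3) (L := L) (fundamentalRep (Fin 2)) β')) ^ 2
                    ∂(wilsonMeasure (d := 3) (L := L) (fundamentalRep (Fin 2)) β')) ∧
            (∀ (A : Set (GaugeConfig 3 L (Matrix.specialUnitaryGroup (Fin 2) ℂ))), MeasurableSet A → ∀ t : ℝ≥0,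
              ((P.map (U (t₁ + t))).real A - (wilsonMeasure (d := 3) (L := L) (fundamentalRep (Fin 2)) β').real A) ^ 2 ≤
                D * Real.exp (-2 * c * t) * ((wilsonMeasure (d := 3) (L := L) (fundamentalRep (Fin 2)) β').real A *
                  (1 - (wilsonMeasure (d := 3) (L := L) (fundamentalRep (Fin 2)) β').real A))) := by
  classical
  haveI := secondCountableTopology_su2
  haveI := borelSpace_config L
  haveI : IsProbabilityMeasure (wilsonMeasure (d := 3) (L := L) (fundamentalRep (Fin 2)) β') :=
    isProbabilityMeasure_wilsonMeasure (d := 3) (L := L) (fundamentalRep (Fin 2)) (continuous_fundamentalRep (Fin 2)) β'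
  obtain ⟨c, hc, hgap⟩ := wilson_spectralGap_measurable L β'
  refine ⟨c, hc, fun z t₁ ht₁ => ?_⟩
  set μ : Measure (GaugeConfig 3 L (Matrix.specialUnitaryGroup (Fin 2) ℂ)) :=
    wilsonMeasure (d := 3) (L := L) (fundamentalRep (Fin 2)) β' with hμ
  -- THE kernels and the density bound at time `t₁`
  obtain ⟨κ, hκ, -, hreal⟩ := exists_transitionKernel L β'
  haveI := hκ
  obtain ⟨a, ha, -, hπle⟩ := wilsonMeasure_le_smul_pi_haar_and (L := L) β'
  haveI := isProbabilityMeasure_piWiener (Edge 3 L × NoiseIdx 2)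
  have hWc := isFlatBrownian_piWiener 3 L (NoiseIdx 2)
  obtain ⟨Uc, hUc0, hUc⟩ := solution_from_start hWc β' z
  obtain ⟨C₁, hC₁, hle₁⟩ := map_le_smul_haar (L := L) β' ht₁ z hWc hUc0 hUc
  have hκle : κ t₁ z ≤ (ENNReal.ofReal (C₁ * a)) • μ := by
    rw [hreal t₁ z _ _ _ hWc Uc hUc0 hUc, ENNReal.ofReal_mul hC₁, Measure.le_iff]
    intro A hA
    have e1 := Measure.le_iff.1 hle₁ A hA
    have e2 := Measure.le_iff.1 hπle A hA
    simp only [Measure.smul_apply, smul_eq_mul] at e1 e2 ⊢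
    calc (Measure.map (Uc t₁) (Measure.pi fun _ : Edge 3 L × NoiseIdx 2 => preWienerMeasure)) A
        ≤ ENNReal.ofReal C₁ * (Measure.pi fun _ : Edge 3 L => haarProbability (Matrix.specialUnitaryGroup (Fin 2) ℂ)) A := e1
      _ ≤ ENNReal.ofReal C₁ * (ENNReal.ofReal a * μ A) := mul_le_mul' le_rfl e2
      _ = ENNReal.ofReal C₁ * ENNReal.ofReal a * μ A := (mul_assoc _ _ _).symm
  refine ⟨C₁ * a, by positivity, fun Ω _ P _ W hW U hU0 hU => ?_⟩
  -- (i) bounded measurable observables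
  have hobs : ∀ (F : GaugeConfig 3 L (Matrix.specialUnitaryGroup (Fin 2) ℂ) → ℝ), Measurable F →
      ∀ M : ℝ, (∀ x, |F x| ≤ M) → ∀ t : ℝ≥0,
      ((∫ ω, F (U (t₁ + t) ω) ∂P) - ∫ x, F x ∂μ) ^ 2 ≤
        C₁ * a * Real.exp (-2 * c * t) * ∫ x, (F x - ∫ z, F z ∂μ) ^ 2 ∂μ := by
    intro F hF M hM t
    have hFi : ∀ (ν : Measure (GaugeConfig 3 L (Matrix.specialUnitaryGroup (Fin 2) ℂ))) [IsProbabilityMeasure ν],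
        Integrable F ν := fun ν _ => integrable_of_abs_le ν hF hM
    have hmU : Measurable (U (t₁ + t)) := (hU.adapted (t₁ + t)).mono (hW.natFiltration.le (t₁ + t)) le_rfl
    have hE : ∫ ω, F (U (t₁ + t) ω) ∂P = ∫ y, (∫ y', F y' ∂(κ t y)) ∂(κ t₁ z) := by
      rw [← integral_map hmU.aemeasurable hF.aestronglyMeasurable, ← hreal (t₁ + t) z Ω P W hW U hU0 hU,
        chapmanKolmogorov_szz β' κ hreal t₁ t]
      haveI : IsProbabilityMeasure ((κ t ∘ₖ κ t₁) z) := by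
        rw [← chapmanKolmogorov_szz β' κ hreal t₁ t]; infer_instance
      exact Kernel.integral_comp (hFi _)
    set m : ℝ := ∫ x, F x ∂μ with hm
    have hκFm : Measurable fun y => ∫ y', F y' ∂(κ t y) := (hF.stronglyMeasurable.integral_kernel (κ := κ t)).measurable
    have hκFb : ∀ y, |(∫ y', F y' ∂(κ t y)) - m| ≤ M + M := fun y =>
      (abs_sub _ _).trans (add_le_add (abs_integral_le_of_abs_le_of_isProbabilityMeasure hM)
        (abs_integral_le_of_abs_le_of_isProbabilityMeasure hM))
    have hcent : (∫ ω, F (U (t₁ + t) ω) ∂P) - m = ∫ y, ((∫ y', F y' ∂(κ t y)) - m) ∂(κ t₁ z) := by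
      rw [hE, integral_sub (integrable_of_abs_le _ hκFm (C := M)
        fun y => abs_integral_le_of_abs_le_of_isProbabilityMeasure hM) (integrable_const m)]
      simp
    rw [hcent]
    have hJ := sq_integral_le_mul_integral_sq_of_measurable (by positivity : (0 : ℝ) ≤ C₁ * a) hκle
      (hκFm.sub measurable_const) hκFb
    have hvar := (hgap κ hreal).1 F hF M hM t
    calc (∫ y, ((∫ y', F y' ∂(κ t y)) - m) ∂(κ t₁ z)) ^ 2
        ≤ (C₁ * a) * ∫ y, ((∫ y', F y' ∂(κ t y)) - m) ^ 2 ∂μ := hJ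
      _ ≤ (C₁ * a) * (Real.exp (-2 * c * t) * ∫ x, (F x - m) ^ 2 ∂μ) :=
          mul_le_mul_of_nonneg_left hvar (by positivity)
      _ = C₁ * a * Real.exp (-2 * c * t) * ∫ x, (F x - m) ^ 2 ∂μ := by ring
  refine ⟨hobs, fun A hA t => ?_⟩
  -- (ii) events: `F = 1_A`
  have h1A : ∀ x : GaugeConfig 3 L (Matrix.specialUnitaryGroup (Fin 2) ℂ),
      |A.indicator (1 : GaugeConfig 3 L (Matrix.specialUnitaryGroup (Fin 2) ℂ) → ℝ) x| ≤ 1 := by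
    intro x
    by_cases hx : x ∈ A
    · simp [Set.indicator_of_mem hx]
    · simp [Set.indicator_of_notMem hx]
  have h := hobs (A.indicator (1 : GaugeConfig 3 L (Matrix.specialUnitaryGroup (Fin 2) ℂ) → ℝ))
    (measurable_one.indicator hA) 1 h1A t
  have hmU : Measurable (U (t₁ + t)) := (hU.adapted (t₁ + t)).mono (hW.natFiltration.le (t₁ + t)) le_rfl
  have e1 : ∫ ω, A.indicator (1 : GaugeConfig 3 L (Matrix.specialUnitaryGroup (Fin 2) ℂ) → ℝ) (U (t₁ + t) ω) ∂P =
      (P.map (U (t₁ + t))).real A := by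
    rw [← integral_map hmU.aemeasurable ((measurable_one.indicator hA).aestronglyMeasurable), integral_indicator_one hA]
  rw [e1, integral_indicator_one hA, integral_indicator_sub_sq _ hA] at h
  exact h

end Summit.QuantumFields.YangMills.Theorems.ColdStartUniversality

end
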